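import Summits.BirchSwinnertonDyer.BirchSwinnertonDyer.Theorems.KatoDescentPotSupersingularFineSelmerLeSignedSelmer
import Summits.BirchSwinnertonDyer.Rank1Residual.Additive.StrictSignedSelmerPreimageZeroPadic
import Literature.NumberTheory.EllipticCurves.Greenberg1999.ControlLocalKernelsLayerGoodProofs
import Literature.NumberTheory.EllipticCurves.SelmerCorankControlRatProofs
import HarnessLib

/-!
# `Sel_{p^∞}(E/K_∞) = ⋃ₙ res Sel_{p^∞}(E/K_n)`: the classical Selmer group over a `ℤ_p`-extension IS
# the direct limit of the layer Selmer groups (route `KatoDescentPotSupersingular`, rung K9, cell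
# `bsd-potss`; a `--supports … --as helper` file; seat `bsd-potss-k9-c4` g5; ROUTE-FREE; a tool theorem,
# nothing booked, BSD is not proved by any of this)

WHY. The tree DEFINES `WeierstrassCurve.selmerInfty κ` by local conditions directly over `K_∞`
(`selmerGroupOver (ker κ)`) and proves only `res (Sel(E/K_n)) ≤ Sel(E/K_∞)`
(`map_layerToInfty_selmerLayer_le_holds`); its docstring's "i.e. `lim→ Sel_{p^∞}(E/K_n)`"
(Mazur 1972 §6, Greenberg LNM 1716 §1) was not a theorem. The bridge file of this seat
(`…FineSelmerLeSignedSelmer.lean`, p466275) proved the harder signed containment; the same descent gives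
the classical statement, recorded here for the tree's other consumers (control-theorem counts, the
x1b / ctrl level-`∞` comparisons): **`selmerInfty_eq_iSup_map_layerToInfty_selmerLayer`** — for `W/K`
elliptic over a number field and ANY `ℤ_p`-extension `κ`,
`W.selmerInfty κ = ⨆ₙ (W.selmerLayer κ n).map (W.layerToInfty κ n)`.
Proof of `≤`: `c = h_n(y)` (`FineSelmerLeSignedSelmer.exists_layerToInfty_eq`); the local conditions of
the `p^n` conjugates `conj_{γ^i} y` at the finitely many bad places / places above `p` descend to one
layer `m ≥ n` (`exists_forall_resOfLe_localSubgroup_eq_zero_of_mem_localTowerKer`); off that set they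
hold at every layer (Greenberg's Lemma 3.3 `localTowerKerPrimary_eq_bot_of_hasGoodReductionAt`, classes
being `p`-power torsion) and at `∞` (split completely); so `res_{K_m/K_n} y ∈ Sel(E/K_m)` and
`c = h_m(res y)`. The finite bad set comes from x1b's `exists_finset_forall_not_mem_good`.

References: [Mazur1972] §6; [GreenbergLNM1716] §1 (p. 60), §3 Lemmas 3.2–3.3 (pp. 85–88);
[SerreGaloisCohomology1997] I.§2.2 Prop. 8.
-/

set_option autoImplicit false
-- sibling precedent (`KatoDescentPotSupersingularAssembly.lean`): the directory name repeats the summit name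
set_option linter.dupNamespace false

noncomputable section

open scoped Classical

universe u

namespace Summit.BirchSwinnertonDyer.BirchSwinnertonDyer.Theorems.FineSelmerLeSignedSelmer

open NumberField IsDedekindDomain Field
open Literature.NumberTheory.EllipticCurves Literature.NumberTheory.EllipticCurves.ZpExtension
  Literature.NumberTheory.GaloisRepresentations
  Summit.BirchSwinnertonDyer.Rank1Residual.Additive
  Summit.BirchSwinnertonDyer.BirchSwinnertonDyer.Theorems

variable {K : Type u} [Field K] [NumberField K] (W : WeierstrassCurve K) {p : ℕ} [Fact p.Prime]
  (κ : ZpExtension K p)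

/-- **Every class of `Sel_{p^∞}(E/K_∞)` is a restriction of a class of some `Sel_{p^∞}(E/K_m)`**, given
a finite set `S` of finite places off which `W` is good and `v ∤ p`: the descent of the bridge file with
the classical conditions only. [cite: GreenbergLNM1716, §3 Lemmas 3.2–3.3 (pp. 86–88) and p. 90]
[cite: Mazur1972, §6] -/
theorem exists_mem_selmerLayer_layerToInfty_eq [W.IsElliptic] (S : Finset (HeightOneSpectrum (𝓞 K)))
    (hS : ∀ v ∉ S, ((p : ℕ) : 𝓞 K) ∉ v.asIdeal ∧ W.HasGoodReductionAt v)
    {c : W.subgroupH1 p κ.kerSubgroup} (hc : c ∈ W.selmerInfty κ) :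
    ∃ (m : ℕ) (y : W.subgroupH1 p (κ.layerSubgroup m)), y ∈ W.selmerLayer κ m ∧
      W.layerToInfty κ m y = c := by
  obtain ⟨n, y, rfl⟩ := exists_layerToInfty_eq W κ c
  obtain ⟨γ, hγ⟩ := κ.surjective (Multiplicative.ofAdd 1)
  have hγ' : κ.IsTopGenerator γ := hγ
  have hyA : y ∈ W.selmerInftyPreimage κ n := (W.mem_selmerInftyPreimage_iff κ n y).2 hc
  have hcl := fun (vi : ↥S × Fin (p ^ n)) ↦
    exists_forall_resOfLe_localSubgroup_eq_zero_of_mem_localTowerKer W κ (vi.1.1.adicCompletion K) n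
      (W.localResOver_conjH1_mem_localTowerKer_of_mem κ hyA vi.1.1 (γ ^ (vi.2 : ℕ)))
  choose mc hmc using hcl
  set m : ℕ := max n (Finset.univ.sup mc) with hm
  have hnm : n ≤ m := le_max_left _ _
  have hmc' : ∀ vi, mc vi ≤ m := fun vi ↦ (Finset.le_sup (Finset.mem_univ vi)).trans (le_max_right _ _)
  set ym : W.subgroupH1 p (κ.layerSubgroup m) := W.resOfLe p (κ.layerSubgroup_antitone hnm) y with hym
  have hcm : W.layerToInfty κ m ym = W.layerToInfty κ n y := layerToInfty_resOfLe_layer W κ hnm y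
  have hymA : ym ∈ W.selmerInftyPreimage κ m := by
    rw [W.mem_selmerInftyPreimage_iff, hcm]; exact hc
  refine ⟨m, ym, ?_, hcm⟩
  change ym ∈ W.selmerGroupOver p (κ.layerSubgroup m)
  rw [WeierstrassCurve.mem_selmerGroupOver_iff]
  refine ⟨fun v σ ↦ ?_, fun w σ ↦ ?_⟩
  · rw [WeierstrassCurve.mem_localKerOver_iff]
    by_cases hv : v ∈ S
    · obtain ⟨i, hi, hiσ⟩ := exists_conjH1_eq_conjH1_pow_of_lt W κ hγ' n σ y
      rw [hym, conjH1_resOfLe_layer W κ hnm, hiσ, localResOver_resOfLe_layer W κ hnm]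
      exact hmc (⟨v, hv⟩, ⟨i, hi⟩) m hnm (hmc' _)
    · have hK := W.localResOver_conjH1_mem_localTowerKer_of_mem κ hymA v σ
      obtain ⟨k, hk⟩ := W.exists_pow_smul_subgroupH1_layer_eq_zero κ m (W.conjH1 p (κ.layerSubgroup m) σ ym)
      have hprim : W.localResOver p (κ.layerSubgroup m) (v.adicCompletion K)
          (W.conjH1 p (κ.layerSubgroup m) σ ym) ∈ W.localTowerKerPrimary κ (v.adicCompletion K) m :=
        (W.mem_localTowerKerPrimary_iff κ _ m _).2 ⟨hK, k, by rw [← map_nsmul, hk, map_zero]⟩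
      rw [Greenberg1999.localTowerKerPrimary_eq_bot_of_hasGoodReductionAt W κ (hS v hv).1 (hS v hv).2 m,
        AddSubgroup.mem_bot] at hprim
      exact hprim
  · rw [WeierstrassCurve.mem_localKerOver_iff]
    have hK := W.localResOver_conjH1_mem_localTowerKer_of_mem_infinitePlace κ hymA w σ
    rw [W.localTowerKer_eq_bot_of_forall_mem κ w.Completion m
      (ZpExtension.resGal_infinitePlace_mem_kerSubgroup κ w), AddSubgroup.mem_bot] at hK
    exact hK

/-- **`Sel_{p^∞}(E/K_∞) = lim→ₙ Sel_{p^∞}(E/K_n)`** — the tree's Selmer group over a `ℤ_p`-extension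
(defined by local conditions over `K_∞`) EQUALS the union of the images of the layer Selmer groups, for
every elliptic curve over a number field and every `ℤ_p`-extension (`≥`: the tree's
`map_layerToInfty_selmerLayer_le_holds`; `≤`: `exists_mem_selmerLayer_layerToInfty_eq` with the finite
bad set of x1b's `exists_finset_forall_not_mem_good`). [cite: Mazur1972, §6]
[cite: GreenbergLNM1716, §1 p. 60 and §3 pp. 85–90] -/
theorem selmerInfty_eq_iSup_map_layerToInfty_selmerLayer [W.IsElliptic] :
    W.selmerInfty κ = ⨆ n : ℕ, (W.selmerLayer κ n).map (W.layerToInfty κ n) := by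
  refine le_antisymm (fun c hc ↦ ?_) (iSup_le fun n ↦ W.map_layerToInfty_selmerLayer_le_holds κ n)
  obtain ⟨S, hS⟩ := exists_finset_forall_not_mem_good W p
  obtain ⟨m, y, hy, rfl⟩ := exists_mem_selmerLayer_layerToInfty_eq W κ S hS hc
  exact (le_iSup (fun n ↦ (W.selmerLayer κ n).map (W.layerToInfty κ n)) m) ⟨y, hy, rfl⟩

/-- Likewise **`Sel₀(K_∞, E[p^∞]) ≤ ⨆ₙ res Sel^ε(E/K_n) = Sel^ε(E/K_∞)` with the bad set discharged** is
`WildFineSelmerSupersingularCMAnchor.fineSelmerInfty_le_signedSelmerInfty'`; here the membership form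
of the classical statement for direct use: `c ∈ Sel(E/K_∞)` iff `c = h_m(y)` for some `y ∈ Sel(E/K_m)`.
[cite: Mazur1972, §6] [cite: GreenbergLNM1716, §1 p. 60] -/
theorem mem_selmerInfty_iff_exists_layer [W.IsElliptic] (c : W.subgroupH1 p κ.kerSubgroup) :
    c ∈ W.selmerInfty κ ↔ ∃ (m : ℕ) (y : W.subgroupH1 p (κ.layerSubgroup m)),
      y ∈ W.selmerLayer κ m ∧ W.layerToInfty κ m y = c := by
  constructor
  · intro hc
    obtain ⟨S, hS⟩ := exists_finset_forall_not_mem_good W p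
    exact exists_mem_selmerLayer_layerToInfty_eq W κ S hS hc
  · rintro ⟨m, y, hy, rfl⟩
    exact W.map_layerToInfty_selmerLayer_le_holds κ m ⟨y, hy, rfl⟩

end Summit.BirchSwinnertonDyer.BirchSwinnertonDyer.Theorems.FineSelmerLeSignedSelmer

end
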